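import Summits.MatrixMultiplication.MatrixMultiplication.Theorems.FarEdgeDescentZeroWeightMember
import Summits.MatrixMultiplication.MatrixMultiplication.Theorems.FarEdgeDescentTwistBorderRank
import Literature.Computability.AlgebraicComplexity.TwoByTwoRankLowerBound
import Literature.Computability.AlgebraicComplexity.BorderRankDirectSum
import HarnessLib

/-!
# Far-edge descent, Kernel XI-a — the zero-weight member has border rank and rank exactly six

Support for `Summit.MatrixMultiplication.MatrixMultiplication.Theses.FarEdgeDescent`
(aside `SubLogRate`; lens «structural dichotomy (special vs generic)», generation 36).

Kernel X-c (`FarEdgeDescentZeroWeightMember`) left the zero-weight member `𝔖(0) = fam K 0` of the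
BCZ line (`⟨2,2,2⟩` with the product `a₂₁ b₁₂ → c₂₂` deleted; BCZ's `⟨2,2,2⟩₀`) with the rank
window `4 ≤ R(𝔖(0)) ≤ 6`.  This file closes the classical invariants of the special member and of
the whole line **exactly**:

* (§1–2) an integer `p = 1` Koszul–Young flattening of `𝔖(0)` (second factor wedged, projection
  `K⁴ → K³`) has `11` rows certified independent with **unit pivots**, so **`6 ≤ R̲(𝔖(0))` over
  every field**; with De Groote's six triads, **`R̲(𝔖(0)) = R(𝔖(0)) = 6` over every field**
  (`algBorderRank_fam_zero`, `tensorRank_fam_zero`);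
* (§3) the coherent member is `⟨2,2,2⟩` up to restriction in both directions, so
  **`R(𝔖(1)) = 7` over every field** and, by the rank-one coupling `𝔖(q) = 𝔖(q') + (q−q')•E`,
  **`6 ≤ R(𝔖(q)) ≤ 7` for every `q` over every field**: the rank drops on the line exactly to `6`
  and it does drop at the special member `q = 0`;
* (§4) over `ℂ`, given Landsberg's `R̲(⟨2,2,2⟩) = 7` (the named fact
  `Landsberg2005_borderRank_matMulTensor_two`): **`R̲(𝔖(1)) = 7`, `6 ≤ R̲(𝔖(q)) ≤ 7` for every
  `q`, and `R̲(𝔖(0)) = 6 < 7 = R̲(𝔖(1))`** — border rank SEPARATES the special member from the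
  coherent one, while (Kernel X-c) the flattening rank (`= 4` along the whole line) does not;
  unconditionally and over every field `5 ≤ R̲(𝔖(q))`, `6 ≤ R̲(𝔖(1)) ≤ 7`, and `𝔖(0) ≱ 𝔖(1)`.

For the lens: `R̲`/`R` are upper bounds for `R̃` only, so `R̲(𝔖(0)) = 6` does **not** certify the
special value `R̃(𝔖(0))`; what it shows is that every classical invariant in the tree places the
zero-weight member at most one unit below the generic member, exactly as the asymptotic coupling
`R̃(𝔖(0)) ≥ R̃(𝔖(q)) − 1` (Kernel X-a) does.

## References

* J. M. Landsberg, G. Ottaviani, *New lower bounds for the border rank of matrix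
  multiplication*, Theory Comput. 11 (2015), Thm. 2.1 (Koszul–Young flattenings).
  [LandsbergOttaviani2015]
* M. Bläser, M. Christandl, J. Zuiddam, *The border support rank of two-by-two matrix
  multiplication is seven*, arXiv:1705.09652 (2017), §2 (Thm. 4: De Groote; Def. 5; proof of
  Thm. 2). [BlaserChristandlZuiddam2017]
* J. M. Landsberg, *The border rank of the multiplication of 2×2 matrices is seven*, J. Amer.
  Math. Soc. 19 (2006), 447–459. [Landsberg2005]
* P. Bürgisser, M. Clausen, M. A. Shokrollahi, *Algebraic Complexity Theory* (1997), Cor. (17.10)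
  (`R(⟨2,2,2⟩) = 7`), §15.2. [BurgisserClausenShokrollahi1997]
* M. Bläser, *Fast Matrix Multiplication*, Theory of Computing Library, Graduate Surveys 5
  (2013), Def. 6.1, Rem. 6.2. [Blaser2013]
-/

noncomputable section

open scoped BigOperators

set_option linter.dupNamespace false

namespace Summit.MatrixMultiplication.MatrixMultiplication.Theorems.FarEdgeDescentZeroWeightBorderRank

open Literature.Computability.AlgebraicComplexity
open Literature.LinearAlgebra.Matrix
open Summit.MatrixMultiplication.MatrixMultiplication.Theorems.FarEdgeDescentTwistRigidity
open Summit.MatrixMultiplication.MatrixMultiplication.Theorems.FarEdgeDescentSignTwist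
open Summit.MatrixMultiplication.MatrixMultiplication.Theorems.FarEdgeDescentSignTwistDet
open Summit.MatrixMultiplication.MatrixMultiplication.Theorems.FarEdgeDescentSignTwistComm
open Summit.MatrixMultiplication.MatrixMultiplication.Theorems.FarEdgeDescentSignTwistCommPow
open Summit.MatrixMultiplication.MatrixMultiplication.Theorems.FarEdgeDescentWeightFamily
open Summit.MatrixMultiplication.MatrixMultiplication.Theorems.FarEdgeDescentGenericDomination
open Summit.MatrixMultiplication.MatrixMultiplication.Theorems.FarEdgeDescentRankOneCoupling
open Summit.MatrixMultiplication.MatrixMultiplication.Theorems.FarEdgeDescentZeroWeightMember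
open Summit.MatrixMultiplication.MatrixMultiplication.Theorems.FarEdgeDescentTwistBorderRank

/-! ## §1 The zero-weight member as an integer table -/

/-- `𝔖(0)` as an integer `4 × 4 × 4` table: leaves `inl i ↦ i`, `inr i ↦ 2 + i`, `x = (x₁,x₂) ↦
2x₁ + x₂`; entries `(i, (i,k), k)` (left block) and `(2+i, (i,k), 2+k)` (right block) except the
deleted right-block entry of `x = (1,0)`. [cite: BlaserChristandlZuiddam2017, Def. 5] -/
def famZZ : Fin 4 → Fin 4 → Fin 4 → ℤ :=
  ApproxCert.ofEntries 4 4 4 [((0, 0, 0), 1), ((0, 1, 1), 1), ((1, 2, 0), 1), ((1, 3, 1), 1),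
    ((2, 0, 2), 1), ((2, 1, 3), 1), ((3, 3, 3), 1)]

/-- Integer mirror of the side weights `wS K 0`: `0` at the right-block entry of `x = (1,0)`,
`1` elsewhere. [folklore] -/
def wS0Z (σ : Fin 2) (x : Fin 2 × Fin 2) : ℤ := if σ = 1 then (if x = (1, 0) then 0 else 1) else 1

/-- The table `famZZ` in closed form (kernel check of all `64` entries). [folklore] -/
theorem famZZ_closed : ∀ a x c, famZZ (leafIdx a) (xIdx x) (leafIdx c) =
    if side a = side c ∧ x = (row a, row c) then wS0Z (side a) x else 0 := by
  decide

section Field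

variable (K : Type) [Field K]

/-- `wS K 0` is the cast of its integer mirror. [folklore] -/
theorem wS_zero_eq_cast (σ : Fin 2) (x : Fin 2 × Fin 2) : wS K 0 σ x = ((wS0Z σ x : ℤ) : K) := by
  unfold wS famW wS0Z
  split_ifs <;> simp

/-- **`𝔖(0) = famZZ`** read through the index bijections. [cite: BlaserChristandlZuiddam2017, Def. 5] -/
theorem fam_zero_eq_famZZ :
    fam K 0 = fun a x c => ((famZZ (leafIdx a) (xIdx x) (leafIdx c) : ℤ) : K) := by
  funext a x c
  rw [fam_apply, famZZ_closed]
  split_ifs <;> simp [wS_zero_eq_cast]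

end Field

/-! ## §2 The Koszul–Young certificate: `R̲(𝔖(0)) = R(𝔖(0)) = 6` over every field -/

/-- Projection `K⁴ → K³` of the wedged (second) factor. [cite: LandsbergOttaviani2015, Thm. 2.1] -/
def kyM0 : List (List ℤ) := [[0, 0, 0, 1], [0, 1, 1, 0], [1, 0, 0, 0]]

/-- Row combinations certifying rank `11` of the Koszul–Young flattening of `𝔖(0)` (second factor
wedged); eight rows are taken as they stand, three are cleared by one earlier row each. [folklore] -/
def rows0 : List (List (ℕ × ℤ)) :=
  [[(0, 1)], [(2, 1)], [(3, 1)], [(4, 1)], [(5, 1)], [(6, 1)], [(7, 1)], [(9, 1)],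
    [(1, 1), (4, -1)], [(5, -1), (8, 1)], [(7, -1), (10, 1)]]

/-- Pivot columns for `rows0`. [folklore] -/
def piv0 : List ℕ := [1, 3, 7, 0, 9, 2, 11, 8, 5, 4, 6]

/-- **The Koszul–Young flattening of `𝔖(0)` has rank `≥ 11`, with unit pivots** (kernel check).
[cite: LandsbergOttaviani2015, Thm. 2.1] -/
theorem famZZ_ky :
    intTriCheckUnit 11 (KYCert.kyEntry 4 4 4 kyM0 (fun j l i => famZZ i j l)) rows0 piv0 =
      true := by
  decide +kernel

section Field

variable (K : Type) [Field K]

/-- **`6 ≤ R̲(𝔖(0))` over every field**: `11 > 2 · 5` certified rows of a `p = 1` Koszul–Young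
flattening. [cite: LandsbergOttaviani2015, Thm. 2.1] -/
theorem six_le_algBorderRank_fam_zero : 6 ≤ algBorderRank (fam K 0) := by
  rw [fam_zero_eq_famZZ K,
    algBorderRank_reindex leafIdx xIdx leafIdx (fun i j l => ((famZZ i j l : ℤ) : K))]
  exact KYCert.le_algBorderRank_of_rotate₁ K famZZ
    (KYCert.le_algBorderRank_of_kyCheckUnit K kyM0 (fun j l i => famZZ i j l) famZZ_ky
      (by norm_num))

/-- **`R̲(𝔖(0)) = 6` over every field** (upper bound: De Groote's six triads, Kernel X-c).
[cite: LandsbergOttaviani2015, Thm. 2.1] [cite: BlaserChristandlZuiddam2017, Thm. 4] -/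
theorem algBorderRank_fam_zero : algBorderRank (fam K 0) = 6 :=
  le_antisymm ((algBorderRank_le_tensorRank _).trans tensorRank_fam_zero_le_six)
    (six_le_algBorderRank_fam_zero K)

/-- **`R(𝔖(0)) = 6` over every field.** [cite: BlaserChristandlZuiddam2017, Thm. 4]
[cite: LandsbergOttaviani2015, Thm. 2.1] -/
theorem tensorRank_fam_zero : tensorRank (fam K 0) = 6 :=
  le_antisymm tensorRank_fam_zero_le_six
    ((six_le_algBorderRank_fam_zero K).trans (algBorderRank_le_tensorRank _))

/-- Over every field `R̃(𝔖(0)) ≤ 6 = R̲(𝔖(0))`: the border-rank door is shut at the special member —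
no classical (border-)rank bound can certify `R̃(𝔖(0)) < 6`. [cite: Strassen1988, Thm. 3.9] -/
theorem asymptoticRank_fam_zero_le_algBorderRank :
    asymptoticRank (fam K 0) ≤ (algBorderRank (fam K 0) : ℝ) := by
  rw [algBorderRank_fam_zero]
  exact_mod_cast asymptoticRank_fam_zero_le_six

/-! ## §3 The coherent member and the rank profile of the line over every field -/

/-- `⟨2,2,2⟩ ≥ 𝔖(1)` and `𝔖(1) ≥ ⟨2,2,2⟩` (restriction both ways). [folklore] -/
theorem fam_one_restricts :
    TensorRestrictsTo (matMulTensor K 2 2 (1 + 1)) (fam K 1) ∧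
      TensorRestrictsTo (fam K 1) (matMulTensor K 2 2 (1 + 1)) := by
  rw [fam_one]
  exact ⟨matMul_restrictsTo_permStar IsProdPerm.refl, permStar_restrictsTo_matMul IsProdPerm.refl⟩

/-- **`R(𝔖(1)) = R(⟨2,2,2⟩) = 7` over every field.** [cite: BurgisserClausenShokrollahi1997, Cor. (17.10)] -/
theorem tensorRank_fam_one : tensorRank (fam K 1) = 7 := by
  obtain ⟨-, h₂⟩ := fam_one_restricts K
  have h7 : 7 ≤ tensorRank (matMulTensor K 2 2 (1 + 1)) := seven_le_tensorRank_matMulTensor_two K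
  exact le_antisymm (tensorRank_fam_le_seven 1) (h7.trans h₂.tensorRank_le)

/-- **`R̲(𝔖(1)) = R̲(⟨2,2,2⟩)` over every field.** [cite: BurgisserClausenShokrollahi1997, §15.2] -/
theorem algBorderRank_fam_one_eq :
    algBorderRank (fam K 1) = algBorderRank (matMulTensor K 2 2 2) := by
  obtain ⟨h₁, h₂⟩ := fam_one_restricts K
  exact le_antisymm (h₁.algBorderRank_le.trans le_rfl) (le_rfl.trans h₂.algBorderRank_le)

/-- `s + t` is a restriction of `s ⊕ t` (identify the two copies of each index set).
[cite: BurgisserClausenShokrollahi1997, (14.23)] -/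
theorem directSum_restrictsTo_add {ι κ μ : Type} [Fintype ι] [Fintype κ] [Fintype μ]
    [DecidableEq ι] [DecidableEq κ] [DecidableEq μ] (s t : ι → κ → μ → K) :
    TensorRestrictsTo (directSumTensor s t) (s + t) := by
  refine ⟨fun a' x => Sum.elim (fun a => if a = a' then 1 else 0) (fun a => if a = a' then 1 else 0) x,
    fun b' y => Sum.elim (fun b => if b = b' then 1 else 0) (fun b => if b = b' then 1 else 0) y,
    fun c' z => Sum.elim (fun c => if c = c' then 1 else 0) (fun c => if c = c' then 1 else 0) z,
    fun a' b' c' => ?_⟩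
  simp only [Fintype.sum_sum_type, Sum.elim_inl, Sum.elim_inr, directSumTensor_inl,
    directSumTensor_inr, directSumTensor_inl_inr, directSumTensor_inr_inl, mul_zero,
    Finset.sum_const_zero, add_zero, zero_add]
  have h₁ : ∀ (T : ι → κ → μ → K), (∑ a, ∑ b, ∑ c, (if a = a' then (1 : K) else 0) *
      (if b = b' then 1 else 0) * (if c = c' then 1 else 0) * T a b c) = T a' b' c' := by
    intro T
    rw [Finset.sum_eq_single a' (fun a _ ha => by simp [ha]) (by simp),
      Finset.sum_eq_single b' (fun b _ hb => by simp [hb]) (by simp),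
      Finset.sum_eq_single c' (fun c _ hc => by simp [hc]) (by simp)]
    simp
  have h₂ : (∑ a : ι, ∑ b : κ, ∑ c : μ, (if a = a' then (1 : K) else 0) *
      (if b = b' then 1 else 0) * (if c = c' then 1 else 0) *
        directSumTensor s t (Sum.inl a) (Sum.inl b) (Sum.inr c)) = 0 :=
    Finset.sum_eq_zero fun a _ => Finset.sum_eq_zero fun b _ => Finset.sum_eq_zero fun c _ => by
      simp [directSumTensor]
  have h₃ : (∑ a : ι, ∑ b : κ, ∑ c : μ, (if a = a' then (1 : K) else 0) *
      (if b = b' then 1 else 0) * (if c = c' then 1 else 0) *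
        directSumTensor s t (Sum.inr a) (Sum.inr b) (Sum.inl c)) = 0 :=
    Finset.sum_eq_zero fun a _ => Finset.sum_eq_zero fun b _ => Finset.sum_eq_zero fun c _ => by
      simp [directSumTensor]
  simp only [Finset.sum_add_distrib]
  rw [h₁ s, h₁ t, h₂, h₃, Pi.add_apply, Pi.add_apply, Pi.add_apply]
  ring

/-- **Border rank is subadditive**: `R̲(s + t) ≤ R̲(s) + R̲(t)` (through `s ⊕ t ≥ s + t`).
[cite: BurgisserClausenShokrollahi1997, §15.4] -/
theorem algBorderRank_add_le' {ι κ μ : Type} [Fintype ι] [Fintype κ] [Fintype μ]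
    [DecidableEq ι] [DecidableEq κ] [DecidableEq μ] (s t : ι → κ → μ → K) :
    algBorderRank (s + t) ≤ algBorderRank s + algBorderRank t :=
  (directSum_restrictsTo_add K s t).algBorderRank_le.trans (algBorderRank_directSumTensor_le_add s t)

/-- The coupling term has rank `≤ 1` after scaling: `R(c • E) ≤ 1`. [cite: BlaserChristandlZuiddam2017, Def. 5] -/
theorem tensorRank_smul_E_le_one (c : K) : tensorRank (c • (fam K 1 - fam K 0)) ≤ 1 :=
  (tensorRank_smul_le c _).trans tensorRank_fam_one_sub_fam_zero_le

/-- **Rank coupling on the line**: `R(𝔖(q)) ≤ R(𝔖(q')) + 1` for all `q, q'`, every field.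
[cite: BlaserChristandlZuiddam2017, proof of Thm. 2] -/
theorem tensorRank_fam_le_add_one (q q' : K) : tensorRank (fam K q) ≤ tensorRank (fam K q') + 1 := by
  rw [fam_eq_add_smul q q']
  exact (tensorRank_add_le _ _).trans (Nat.add_le_add_left (tensorRank_smul_E_le_one K _) _)

/-- **Border-rank coupling on the line**: `R̲(𝔖(q)) ≤ R̲(𝔖(q')) + 1` for all `q, q'`, every field.
[cite: BurgisserClausenShokrollahi1997, §15.2] -/
theorem algBorderRank_fam_le_add_one (q q' : K) :
    algBorderRank (fam K q) ≤ algBorderRank (fam K q') + 1 := by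
  rw [fam_eq_add_smul q q']
  exact (algBorderRank_add_le' K _ _).trans (Nat.add_le_add_left
    ((algBorderRank_le_tensorRank _).trans (tensorRank_smul_E_le_one K _)) _)

/-- **The rank profile of the line over every field: `6 ≤ R(𝔖(q)) ≤ 7` for every `q`**, with
`R(𝔖(1)) = 7` and `R(𝔖(0)) = 6`. [cite: BlaserChristandlZuiddam2017, proof of Thm. 2]
[cite: BurgisserClausenShokrollahi1997, Cor. (17.10)] -/
theorem tensorRank_fam_window (q : K) : 6 ≤ tensorRank (fam K q) ∧ tensorRank (fam K q) ≤ 7 := by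
  refine ⟨?_, tensorRank_fam_le_seven q⟩
  have h := tensorRank_fam_le_add_one K 1 q
  rw [tensorRank_fam_one] at h
  omega

/-- **Rank drops on the line only to `6`, and does drop at the special member**:
`{q : R(𝔖(q)) < R(𝔖(1))} = {q : R(𝔖(q)) = 6} ∋ 0`. [cite: BlaserChristandlZuiddam2017, Thm. 4] -/
theorem tensorRank_lt_fam_one_iff (q : K) :
    tensorRank (fam K q) < tensorRank (fam K 1) ↔ tensorRank (fam K q) = 6 := by
  have h := tensorRank_fam_window K q
  rw [tensorRank_fam_one]
  omega

/-- Over every field `5 ≤ R̲(𝔖(q))` for every `q` (coupling with `R̲(𝔖(0)) = 6`) and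
`6 ≤ R̲(𝔖(1)) ≤ 7`. [cite: LandsbergOttaviani2015, Thm. 2.1] [cite: BurgisserClausenShokrollahi1997, §15.2] -/
theorem five_le_algBorderRank_fam (q : K) : 5 ≤ algBorderRank (fam K q) := by
  have h := algBorderRank_fam_le_add_one K 0 q
  rw [algBorderRank_fam_zero] at h
  omega

/-- `6 ≤ R̲(𝔖(1)) ≤ 7` over every field (BCS Problem 15.1 window for `⟨2,2,2⟩`).
[cite: BurgisserClausenShokrollahi1997, Problem 15.1] -/
theorem algBorderRank_fam_one_window :
    6 ≤ algBorderRank (fam K 1) ∧ algBorderRank (fam K 1) ≤ 7 := by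
  refine ⟨?_, (algBorderRank_le_tensorRank _).trans (tensorRank_fam_le_seven 1)⟩
  rw [algBorderRank_fam_one_eq]
  exact six_le_algBorderRank_matMulTensor_two_allFields K

/-- **`𝔖(0) ≱ 𝔖(1)`: the special member does not restrict to the coherent one**, over every field
(rank `6 < 7`). [cite: BurgisserClausenShokrollahi1997, Cor. (17.10)] -/
theorem fam_zero_not_restrictsTo_fam_one : ¬ TensorRestrictsTo (fam K 0) (fam K 1) := fun h => by
  have h' := h.tensorRank_le
  rw [tensorRank_fam_zero, tensorRank_fam_one] at h'
  omega

end Field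

/-! ## §4 Over `ℂ`, with Landsberg's theorem: border rank separates the special member -/

section Landsberg

/-- **`R̲(𝔖(1)) = 7` over `ℂ`**, from Landsberg's `R̲(⟨2,2,2⟩) = 7` (named fact).
[cite: Landsberg2005, main theorem (p. 447)] -/
theorem algBorderRank_fam_one (h : Landsberg2005_borderRank_matMulTensor_two) :
    algBorderRank (fam ℂ 1) = 7 := by
  have h7 : algBorderRank (matMulTensor ℂ 2 2 2) = 7 := h
  rw [algBorderRank_fam_one_eq, h7]

/-- **The border-rank profile of the line over `ℂ`: `6 ≤ R̲(𝔖(q)) ≤ 7` for every `q`.**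
[cite: Landsberg2005, main theorem (p. 447)] [cite: BurgisserClausenShokrollahi1997, §15.2] -/
theorem algBorderRank_fam_window (h : Landsberg2005_borderRank_matMulTensor_two) (q : ℂ) :
    6 ≤ algBorderRank (fam ℂ q) ∧ algBorderRank (fam ℂ q) ≤ 7 := by
  refine ⟨?_, (algBorderRank_le_tensorRank _).trans (tensorRank_fam_le_seven q)⟩
  have h' := algBorderRank_fam_le_add_one ℂ 1 q
  rw [algBorderRank_fam_one h] at h'
  omega

/-- **Border rank separates the special member from the coherent one**:
`R̲(𝔖(0)) = 6 < 7 = R̲(𝔖(1))` over `ℂ` — whereas the flattening rank is `4` along the whole line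
(`flatteningRank_fam`). [cite: Landsberg2005, main theorem (p. 447)]
[cite: LandsbergOttaviani2015, Thm. 2.1] -/
theorem algBorderRank_fam_zero_lt_fam_one (h : Landsberg2005_borderRank_matMulTensor_two) :
    algBorderRank (fam ℂ 0) < algBorderRank (fam ℂ 1) := by
  rw [algBorderRank_fam_zero, algBorderRank_fam_one h]
  norm_num

/-- Over `ℂ` the border rank drops on the line only to `6`, and does drop at `q = 0`:
`R̲(𝔖(q)) < R̲(𝔖(1)) ↔ R̲(𝔖(q)) = 6`. [cite: Landsberg2005, main theorem (p. 447)] -/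
theorem algBorderRank_lt_fam_one_iff (h : Landsberg2005_borderRank_matMulTensor_two) (q : ℂ) :
    algBorderRank (fam ℂ q) < algBorderRank (fam ℂ 1) ↔ algBorderRank (fam ℂ q) = 6 := by
  have h' := algBorderRank_fam_window h q
  rw [algBorderRank_fam_one h]
  omega

end Landsberg

/-! ## §5 Over `ℂ`: the classical profile next to the asymptotic window -/

/-- **The special member over `ℂ`, all invariants side by side**: flattening rank `4`,
`R̲ = R = 6`, and `max(4, 2^ω − 1) ≤ R̃(𝔖(0)) ≤ 6` — the asymptotic value is the only invariant of
`𝔖(0)` in the tree that is not decided. [cite: Strassen1988, Thm. 3.9]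
[cite: LandsbergOttaviani2015, Thm. 2.1] [cite: BlaserChristandlZuiddam2017, Thm. 4] -/
theorem fam_zero_profile :
    flatteningRank (fam ℂ 0) = 4 ∧ algBorderRank (fam ℂ 0) = 6 ∧ tensorRank (fam ℂ 0) = 6 ∧
      (4 : ℝ) ≤ asymptoticRank (fam ℂ 0) ∧ (2 : ℝ) ^ omega ℂ - 1 ≤ asymptoticRank (fam ℂ 0) ∧
        asymptoticRank (fam ℂ 0) ≤ 6 :=
  ⟨flatteningRank_fam 0, algBorderRank_fam_zero ℂ, tensorRank_fam_zero ℂ,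
    four_le_asymptoticRank_fam 0, rpow_omega_sub_one_le_asymptoticRank_fam 0,
    asymptoticRank_fam_zero_le_six⟩

/-- **The coherent member over `ℂ`**: flattening rank `4`, `R̲ = R = 7`, `R̃ = 2^ω`.
[cite: Landsberg2005, main theorem (p. 447)] [cite: Strassen1988, Thm. 3.9] -/
theorem fam_one_profile (h : Landsberg2005_borderRank_matMulTensor_two) :
    flatteningRank (fam ℂ 1) = 4 ∧ algBorderRank (fam ℂ 1) = 7 ∧ tensorRank (fam ℂ 1) = 7 ∧
      asymptoticRank (fam ℂ 1) = (2 : ℝ) ^ omega ℂ :=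
  ⟨flatteningRank_fam 1, algBorderRank_fam_one h, tensorRank_fam_one ℂ, asymptoticRank_fam_one⟩

end Summit.MatrixMultiplication.MatrixMultiplication.Theorems.FarEdgeDescentZeroWeightBorderRank

end
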